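import Literature.AnabelianGeometry.EtaleTheta.Discharge.Sec5Prop55GaloisLeafConnectedBase
import Literature.AnabelianGeometry.EtaleTheta.Discharge.Sec5Prop55SgpCupConjOfBiKummerData
import Literature.AnabelianGeometry.EtaleTheta.Discharge.Sec5OfConnectedTemperoid

/-!
# [EtTh] Prop. 5.5 for the GENUINE §5 data `ofConnectedTemperoidData` over `B^temp(Π^tp_X)⁰` — abc-iut-w4-d099's composed statement with `hIG`, `hσ`, `hfrac` DISCHARGED (Prop. 5.5, pp.327–328 / PDF pp.101–102)

Mochizuki, *The étale theta function …*, Publ. RIMS **45** (2009), Prop. 5.5 pp.327–328 (PDF pp.101–102)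
[cite: MochizukiEtTh2009, Prop 5.5 p.327–328 (PDF pp.101–102)].  Seat abc-iut-L2-t4 (§5 owner), ROW W3-L2-01 «§5 GENUINE DATA»;
PROOF-ONLY: the composition of abc-iut-w4-d099's `ThetaFrobenioid.cyclotomicRigidity_ofBiKummerData_connectedPart` (p425830) with
abc-iut-L6-t23's `hcup_iff_pull_root_mul` (p425515) — i.e. the statement of `cyclotomicRigidity_ofBiKummerData_connectedPart_of_pullRoot`
(`Discharge/Sec5Prop55ConnectedBaseOfPullRoot.lean`, p427547, abc-iut-w4-d099; audited SOUND by this seat; composed here from its two parents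
directly) — at the genuine §5 data
`ThetaFrobenioid.ofConnectedTemperoidData` (`Discharge/Sec5OfConnectedTemperoid.lean`, p427614): there the dictionary is the identity,
the Galois predicate of the setting IS [SemiAnbd] Def. 3.1 (iv) on the underlying `Π^tp_X`-set, and `σ = s^trv_N` is the constructed
section — so three binders of p427547 are THEOREMS: `hIG := fun _ h => h`, `hσ := baseMap_strvOfBiKummerData h R`,
`hfrac := coe_fracOfModel_mul_unit` (abc-iut-L2-t9's [FrdI] Thm. 5.2 unit calculus).  Remaining binder list (verbatim shapes of
p427547, `toB := id`; its `hP` renamed `hPproj`): `hB P hη₀ hdies e he hlift hpre hPproj ν hK hgeom hconst hreach hLc hLi hproj hKR` (+ the data inputs of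
`ofConnectedTemperoidData`).  Nothing restated; nothing of [EtTh] asserted; typed ≠ proved for the named binders; no side taken on
[IUTchIII] Cor. 3.12.
-/

noncomputable section

namespace Literature.AnabelianGeometry.EtaleTheta

open CategoryTheory Opposite FrobenioidCyclotomicRigidity Literature.AlgebraicGeometry.Frobenioids
  Literature.AnabelianGeometry.SemiGraphs Literature.AnabelianGeometry.SemiGraphs.GaloisObjects

universe u₀ v₀ w

namespace ThetaFrobenioid

variable {K : Type u₀} [Field K] {X : SemiGraphs.TemperedArithmeticGroup.{u₀} K} {D₀ : Type u₀} [Category.{v₀} D₀]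
  {V : FrdIMonoidStub.{w}} {T₀ : RealifiedDivisorMonoids (D₀ := D₀) V}
  {VD : FrdICatStub.{u₀ + 1, u₀, w} (ConnectedPart (BTemp X.Pi))}
  {tf : TemperedFrobenioid T₀ (ConnectedPart (BTemp X.Pi)) VD} {hZ : tf.monoidType = MonoidType.Z}
  {hP : ∀ A : (ConnectedPart (BTemp X.Pi))ᵒᵖ, IsPerfect (tf.Φ.carrier A)}
  {NH : Subgroup (Field.absoluteGaloisGroup K) → tf.category → ℕ+ → Prop} {A₀ : tf.category}
  {hA₀ : PreFrobenioid.IsFrobeniusTrivial tf.toElem A₀} {hA₀' : SemiGraphs.IsGaloisObj A₀.base.obj}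
  {pullFrac : ∀ {A A' : (BiKummerSetting.mkOfConnectedTemperoid X tf hZ hP NH A₀ hA₀ hA₀').C} (_ : A' ⟶ A),
    (BiKummerSetting.mkOfConnectedTemperoid X tf hZ hP NH A₀ hA₀ hA₀').biratUnits A →
      (BiKummerSetting.mkOfConnectedTemperoid X tf hZ hP NH A₀ hA₀ hA₀').biratUnits A'}
  {lv N : ℕ+} {l' : ℕ} {RD : RigidData.{max u₀ w} N l'}
  {θ : (BiKummerSetting.mkOfConnectedTemperoid X tf hZ hP NH A₀ hA₀ hA₀').biratUnits
    (BiKummerSetting.mkOfConnectedTemperoid X tf hZ hP NH A₀ hA₀ hA₀').Aodot}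
  {Bl : (BiKummerSetting.mkOfConnectedTemperoid X tf hZ hP NH A₀ hA₀ hA₀').C}
  {Pl : (BiKummerSetting.mkOfConnectedTemperoid X tf hZ hP NH A₀ hA₀ hA₀').FractionPair θ Bl}
  {Rl : (BiKummerSetting.mkOfConnectedTemperoid X tf hZ hP NH A₀ hA₀ hA₀').NthRoot θ Pl lv pullFrac}
  (h : ModelFrobenioid.Hypotheses tf.divisorMonoid tf.ratFnFunctor)
  (Q : FrobenioidTheta.ThetaSubquotientStub.{w} (ConnectedPart (BTemp X.Pi))) (odd_l : Odd (lv : ℕ))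
  (R : (BiKummerSetting.mkOfConnectedTemperoid X tf hZ hP NH A₀ hA₀ hA₀').NthRoot Rl.root Rl.pair N pullFrac)
  (ιX : RD.PiX ≃ₜ* X.Pi) (K' : Type w) [Field K'] (constEmb : K'ˣ →* tf.biratUnitsModel R.BN)
  (constEmb_injective : Function.Injective constEmb)
  (hinvc : ∀ g : Aut R.AN.base,
    pull tf.divisorMonoid g.hom (ModelFrobenioid.div R.pair.num) = ModelFrobenioid.div R.pair.num)
  (hinvp : ∀ y : RD.PiX, y ∈ RD.PiYdd →
    pull tf.divisorMonoid ((BiKummerSetting.mkOfConnectedTemperoid X tf hZ hP NH A₀ hA₀ hA₀').galoisSurj R.AN.base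
      R.αData.isGalois (ιX y)).hom (ModelFrobenioid.div R.pair.den) = ModelFrobenioid.div R.pair.den)

/-- **[EtTh] Proposition 5.5 for the genuine §5 data over `B^temp(Π^tp_X)⁰`** — abc-iut-w4-d099's
`cyclotomicRigidity_ofBiKummerData_connectedPart_of_pullRoot` at `ofConnectedTemperoidData` with `hIG`, `hσ`, `hfrac` DISCHARGED;
residual binders `hB P hη₀ hdies e he hlift hpre hPproj ν hK hgeom hconst hreach hLc hLi hproj hKR` by name (p427547's `hP` renamed `hPproj` here, `hP` being the perfection input of the setting).
[cite: MochizukiEtTh2009, Prop 5.5 p.327–328 (PDF pp.101–102)] -/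
theorem cyclotomicRigidity_ofConnectedTemperoidData_of_pullRoot
    (hB : (ofConnectedTemperoidData h Q odd_l R ιX K' constEmb constEmb_injective hinvc hinvp).IsThetaSaturated
      (ofConnectedTemperoidData h Q odd_l R ιX K' constEmb constEmb_injective hinvc hinvp).BN)
    (P : ThetaSubquotientProj (ofConnectedTemperoidData h Q odd_l R ιX K' constEmb constEmb_injective hinvc hinvp))
    {η₀ : RD.PiYdd → RD.mu} (hη₀ : η₀ ∈ RD.thetaCocycles)
    (hdies : ∀ k : RD.PiYdd, rhoOfBiKummerData R ιX k = 1 → η₀ k = 1)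
    (e : RD.mu → (ofConnectedTemperoidData h Q odd_l R ιX K' constEmb constEmb_injective hinvc hinvp).lDeltaModN
      (ofConnectedTemperoidData h Q odd_l R ιX K' constEmb constEmb_injective hinvc hinvp).BN)
    (he : Function.Surjective e)
    (hlift : ∀ a ∈ (ofConnectedTemperoidData h Q odd_l R ιX K' constEmb constEmb_injective hinvc hinvp).HB,
      a ∈ P.pre _ → ∃ k : RD.PiYdd, (k : RD.PiX) ∈ RD.lDeltaTheta ∧ rhoOfBiKummerData R ιX k = a)
    (hpre : ∀ k : RD.PiYdd, (k : RD.PiX) ∈ RD.lDeltaTheta → rhoOfBiKummerData R ιX k ∈ P.pre _)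
    (hPproj : ∀ (k : RD.PiYdd) (hk : (k : RD.PiX) ∈ RD.lDeltaTheta) (hm : rhoOfBiKummerData R ιX k ∈ P.pre _),
      (QuotientGroup.mk (P.proj _ ⟨rhoOfBiKummerData R ιX k, hm⟩) :
          (ofConnectedTemperoidData h Q odd_l R ιX K' constEmb constEmb_injective hinvc hinvp).lDeltaModN
            (ofConnectedTemperoidData h Q odd_l R ιX K' constEmb constEmb_injective hinvc hinvp).BN) =
        e (RD.thetaMod ⟨k, hk⟩))
    (ν : (ofConnectedTemperoidData h Q odd_l R ιX K' constEmb constEmb_injective hinvc hinvp).lDeltaModN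
        (ofConnectedTemperoidData h Q odd_l R ιX K' constEmb constEmb_injective hinvc hinvp).BN ≃*
      (ofConnectedTemperoidData h Q odd_l R ιX K' constEmb constEmb_injective hinvc hinvp).muTorsion
        (ofConnectedTemperoidData h Q odd_l R ιX K' constEmb constEmb_injective hinvc hinvp).BN
        (ofConnectedTemperoidData h Q odd_l R ιX K' constEmb constEmb_injective hinvc hinvp).N)
    (hK : ∀ η : (ofConnectedTemperoidData h Q odd_l R ιX K' constEmb constEmb_injective hinvc hinvp).HB →
        (ofConnectedTemperoidData h Q odd_l R ιX K' constEmb constEmb_injective hinvc hinvp).lDeltaModN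
          (ofConnectedTemperoidData h Q odd_l R ιX K' constEmb constEmb_injective hinvc hinvp).BN,
      (∀ k : RD.PiYdd, η ⟨rhoOfBiKummerData R ιX k, Subgroup.mem_map_of_mem _ k.2⟩ = e (η₀ k)) →
        FrobenioidThetaBiKummer.ThetaPairKummerClass
          (ofConnectedTemperoidData h Q odd_l R ιX K' constEmb constEmb_injective hinvc hinvp) η ν)
    (hgeom : P.pre R.BN.base ≤ RD.aug.ker.map (rhoOfBiKummerData R ιX))
    (hconst : ∀ δ ∈ RD.aug.ker, ∀ τ : ModelFrobenioid.units R.BN,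
      (tf.ratFnFunctor.map (rhoOfBiKummerData R ιX δ).hom.op).hom (ModelFrobenioid.unit τ.1.hom) =
        ModelFrobenioid.unit τ.1.hom)
    (hreach : LinearlyReachableFromBN
      (ofConnectedTemperoidData h Q odd_l R ιX K' constEmb constEmb_injective hinvc hinvp))
    (hLc : Thm56Sub.LDeltaMapComp
      (ofConnectedTemperoidData h Q odd_l R ιX K' constEmb constEmb_injective hinvc hinvp))
    (hLi : Thm56Sub.LDeltaMapId
      (ofConnectedTemperoidData h Q odd_l R ιX K' constEmb constEmb_injective hinvc hinvp))
    -- the two structural leaves that stay NAMED at the data (laws on the free stub `Q` / `P`, and on `s^⊔-gp`)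
    (hproj : ∀ (g g' : Aut ((ofConnectedTemperoidData h Q odd_l R ιX K' constEmb constEmb_injective hinvc hinvp).base.obj
        (ofConnectedTemperoidData h Q odd_l R ιX K' constEmb constEmb_injective hinvc hinvp).BN))
        (hh : g' ∈ P.pre _), ∃ hgh : g * g' * g⁻¹ ∈ P.pre _,
          (ofConnectedTemperoidData h Q odd_l R ιX K' constEmb constEmb_injective hinvc hinvp).lDeltaMap g.hom
              (P.proj _ ⟨g', hh⟩) = P.proj _ ⟨g * g' * g⁻¹, hgh⟩)
    -- P55-L06c (abc-iut-L6-t23): `hcup` REPLACED by the dictionary law of `toB` and the root's bi-Kummer Galois-equivariance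
    (hKR : ∀ (y₀ y : RD.PiX), y ∈ RD.PiYdd → rhoOfBiKummerData R ιX y ∈ P.pre R.BN.base →
        pull tf.ratFnFunctor ((BiKummerSetting.mkOfConnectedTemperoid X tf hZ hP NH A₀ hA₀ hA₀').galoisSurj R.AN.base R.αData.isGalois (ιX y)).hom
            (pull tf.ratFnFunctor ((BiKummerSetting.mkOfConnectedTemperoid X tf hZ hP NH A₀ hA₀ hA₀').galoisSurj R.AN.base R.αData.isGalois (ιX y₀)).hom
              (MonoidHom.id (tf.biratUnitsModel R.AN) R.root : tf.ratFnFunctor.obj (op R.AN.base))) *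
            (MonoidHom.id (tf.biratUnitsModel R.AN) R.root : tf.ratFnFunctor.obj (op R.AN.base)) =
          pull tf.ratFnFunctor ((BiKummerSetting.mkOfConnectedTemperoid X tf hZ hP NH A₀ hA₀ hA₀').galoisSurj R.AN.base R.αData.isGalois (ιX y)).hom
              (MonoidHom.id (tf.biratUnitsModel R.AN) R.root : tf.ratFnFunctor.obj (op R.AN.base)) *
            pull tf.ratFnFunctor ((BiKummerSetting.mkOfConnectedTemperoid X tf hZ hP NH A₀ hA₀ hA₀').galoisSurj R.AN.base R.αData.isGalois (ιX y₀)).hom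
              (MonoidHom.id (tf.biratUnitsModel R.AN) R.root : tf.ratFnFunctor.obj (op R.AN.base))) :
    CyclotomicRigidity (ofConnectedTemperoidData h Q odd_l R ιX K' constEmb constEmb_injective hinvc hinvp) P hB := by
  delta ThetaFrobenioid.ofConnectedTemperoidData at hB P e hlift hpre hPproj ν hK hreach hLc hLi hproj ⊢
  exact cyclotomicRigidity_ofBiKummerData_connectedPart
    (S := BiKummerSetting.mkOfConnectedTemperoid X tf hZ hP NH A₀ hA₀ hA₀') (pullFrac := pullFrac) (RD := RD) (θ := θ)
    (Bl := Bl) (Pl := Pl) (Rl := Rl) h (fun _ => MonoidHom.id _) Q odd_l R ιX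
    (BiKummerSetting.mkOfConnectedTemperoid_isOpen_ker_galoisSurj X tf hZ hP NH A₀ hA₀ hA₀' R.AN.base R.αData.isGalois)
    (strvOfBiKummerData h R) K' constEmb constEmb_injective
    (hdivc_of_pull_invariant h.isDivisorial R (strvOfBiKummerData h R) (baseMap_strvOfBiKummerData h R) hinvc)
    (hdivp_of_pull_invariant h.isDivisorial R ιX (strvOfBiKummerData h R) (baseMap_strvOfBiKummerData h R) hinvp)
    (fun _ hA => hA) hB P hη₀ hdies e he hlift hpre hPproj ν hK (baseMap_strvOfBiKummerData h R) hgeom hconst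
    hreach hLc hLi hproj
    ((hcup_iff_pull_root_mul (S := BiKummerSetting.mkOfConnectedTemperoid X tf hZ hP NH A₀ hA₀ hA₀') (pullFrac := pullFrac)
      (T := RD.toThetaEnvData) (θ := θ) (Bl := Bl) (Pl := Pl) (Rl := Rl) h (fun _ => MonoidHom.id _) Q odd_l R ιX
      (BiKummerSetting.mkOfConnectedTemperoid_isOpen_ker_galoisSurj X tf hZ hP NH A₀ hA₀ hA₀' R.AN.base R.αData.isGalois)
      (strvOfBiKummerData h R) K' constEmb constEmb_injective
      (hdivc_of_pull_invariant h.isDivisorial R (strvOfBiKummerData h R) (baseMap_strvOfBiKummerData h R) hinvc)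
      (hdivp_of_pull_invariant h.isDivisorial R ιX (strvOfBiKummerData h R) (baseMap_strvOfBiKummerData h R) hinvp)
      (baseMap_strvOfBiKummerData h R)
      (fun s' s'' _ _ _ => BiKummerSetting.coe_fracOfModel_mul_unit tf T₀.isUnit_BΛ s' s'') P).mpr hKR)

end ThetaFrobenioid

end Literature.AnabelianGeometry.EtaleTheta

end
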